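import Summits.AtomisticToContinuum.Crystallization.Theorems.FluxTubeKeplerFloorGivesLayered
import Summits.AtomisticToContinuum.Crystallization.Theorems.FluxTubeKeplerFluxCellKeplerSingleScale

/-!
# `ScaleBlindRung` — SPECIAL-CASE file (F3): the family `ScaleRung I` specialises to the proved floor

Self-contained, sorry-free copy (namespace `…ScaleLadder.Special`) of the graded family of
`Lines/ScaleBlindRung.lean` (scale ladder over `FluxTubeKepler.FloorGivesLayered`, fwd-rung G1 gen 5, seed
g1-AtomisticToContinuum-15223) with its DECIDED member:
* `scaleRung_box : ScaleRung (Set.Icc (47/50) 1)` — the floor `FluxTubeKepler.FloorGivesLayered`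
  (`Theorems.FluxTubeKeplerFloorGivesLayered.FloorGivesLayered_proof`) followed by the proved `PeriodicGivenLayered`;
  the only rewriting is `scaleGood_box_iff` (`a ∈ Set.Icc (47/50) 1 ↔ 47/50 ≤ a ∧ a ≤ 1`).
Also the dial monotonicity `scaleRung_anti` (harder-to-easier = shrinking the unpriced set `I`) and
`scaleRung_box_of_scaleBlindRung`.  The deciding rung `ScaleBlindRung := ScaleRung (Set.Ioi 0)` is the member NOT
decided here.  No `sorry`.
-/

noncomputable section

namespace Summit.AtomisticToContinuum.Crystallization.Cruxes.FluxCellKepler.ScaleLadder.Special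

open scoped BigOperators Classical
open Filter Topology
open Literature.MathematicalPhysics.StatisticalMechanics
open Summit.AtomisticToContinuum.Crystallization.Theorems.FluxCellKeplerSingleScale
  (LayeredGood layeredGood_mono card_bad_le)
open Summit.AtomisticToContinuum.Crystallization.Theorems.ChargedEnergyGapNegative
  (eStar card_mul_eStar_le crysEnergyLimit)

local notation "E3" => EuclideanSpace ℝ (Fin 3)

/-- FLOOR(P₀): `N · e(P₀) ≤ E(x)` for every Lennard-Jones ground state (verbatim the floor's first hypothesis). -/
def Floor (P₀ : PeriodicConfiguration 3) : Prop :=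
  ∀ (N : ℕ) (x : Fin N → E3), IsGroundState lennardJones x →
    (N : ℝ) * P₀.energyPerParticle lennardJones ≤ interactionEnergy lennardJones x

/-- `I`-SCALE-GOOD SITE: some layered template (Hägg word `s`, Barlow registry, rigid motion `A`) with in-plane
spacing `a ∈ I` and interlayer gaps in the SCALED box `[39a/50, 17a/20]` matches the `R`-ball around `x i` two-way
with tolerance `η`.  `I = [47/50, 1]`: the floor's predicate `LayeredGood R η` (`scaleGood_box_iff`);
`I = (0, ∞)`: every spacing (scale-blind). -/
def ScaleGood (I : Set ℝ) (R η : ℝ) {N : ℕ} (x : Fin N → E3) (i : Fin N) : Prop :=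
  ∃ a : ℝ, a ∈ I ∧ ∃ (A : E3 →ₗᵢ[ℝ] E3) (s : ℤ → ℤ) (z : ℤ → ℝ), IsHaggSeq s ∧
    (∀ m : ℤ, 39 / 50 * a ≤ z (m + 1) - z m ∧ z (m + 1) - z m ≤ 17 / 20 * a) ∧
    let S : Set E3 := {p | ∃ m k l : ℤ, p = A (((k : ℝ) • triangularVec₁ a) + ((l : ℝ) • triangularVec₂ a) +
      ((haggLabel s m : ℝ) • barlowOffset a) + (z m • layerNormal 1))}
    (∀ p ∈ S, ‖p‖ ≤ R → ∃ j : Fin N, dist (x j - x i) p ≤ η) ∧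
    (∀ j : Fin N, ‖x j - x i‖ ≤ R → ∃ p ∈ S, dist (x j - x i) p ≤ η)

/-- SCALE-BLIND BUDGET with dial `I`: at every scale `(R,η)` some `c > 0` prices the sites that are not
`I`-scale-good against the excess energy over `N · e(P₀)` (`I = [47/50, 1]`: the floor's budget). -/
def ScaleBudget (I : Set ℝ) (P₀ : PeriodicConfiguration 3) : Prop :=
  ∀ R η : ℝ, 0 < R → 0 < η → ∃ c : ℝ, 0 < c ∧
    ∀ (N : ℕ) (x : Fin N → E3), IsGroundState lennardJones x →
      c * (Nat.card {i : Fin N // ¬ ScaleGood I R η x i} : ℝ) ≤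
        interactionEnergy lennardJones x - (N : ℝ) * P₀.energyPerParticle lennardJones

/-- Periodic windows at every scale along `x` (verbatim the conclusion of `FluxTubeKepler.PeriodicGivenLayered`). -/
def HasPeriodicWindows (x : (N : ℕ) → (Fin N → E3)) : Prop :=
  ∃ P : PeriodicConfiguration 3, ∀ R ε : ℝ, 0 < ε → ∃ᶠ N in atTop, ∃ t : E3,
    (∀ s ∈ P.points, ‖s‖ ≤ R → ∃ i : Fin N, dist (x N i + t) s ≤ ε) ∧
    (∀ i : Fin N, ‖x N i + t‖ ≤ R → ∃ s ∈ P.points, dist (x N i + t) s ≤ ε)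

/-- **The graded family.** `ScaleRung I`: FLOOR and the budget that leaves the spacings in `I` unpriced force
periodic windows along every Lennard-Jones ground-state sequence. -/
def ScaleRung (I : Set ℝ) : Prop :=
  ∀ P₀ : PeriodicConfiguration 3, Floor P₀ → ScaleBudget I P₀ →
    ∀ x : (N : ℕ) → (Fin N → E3), (∀ N, IsGroundState lennardJones (x N)) → HasPeriodicWindows x

/-- **Deciding rung.** The budget need not price the LATTICE CONSTANT at all: pricing only the sites whose
`R`-neighbourhood is not `η`-close to SOME uniformly dilated or compressed admissible layered template (any spacing
`a > 0`, gaps in the scaled box) suffices — the spacing of the windows is then selected by the energy. -/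
def ScaleBlindRung : Prop := ScaleRung (Set.Ioi 0)

/-! ## Predicate bookkeeping -/

theorem scaleGood_mono {I I' : Set ℝ} (hI : I ⊆ I') {R η : ℝ} {N : ℕ} (x : Fin N → E3) (i : Fin N) :
    ScaleGood I R η x i → ScaleGood I' R η x i := by
  rintro ⟨a, ha, A, s, z, hs, hz, h₁, h₂⟩
  exact ⟨a, hI ha, A, s, z, hs, hz, h₁, h₂⟩

theorem layeredGood_of_scaleGood_box {R η : ℝ} {N : ℕ} (x : Fin N → E3) (i : Fin N) :
    ScaleGood (Set.Icc (47 / 50) 1) R η x i → LayeredGood R η x i := by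
  rintro ⟨a, ⟨ha₁, ha₂⟩, A, s, z, hs, hz, h₁, h₂⟩
  exact ⟨a, ha₁, ha₂, A, s, z, hs, hz, h₁, h₂⟩

theorem scaleGood_box_of_layeredGood {R η : ℝ} {N : ℕ} (x : Fin N → E3) (i : Fin N) :
    LayeredGood R η x i → ScaleGood (Set.Icc (47 / 50) 1) R η x i := by
  rintro ⟨a, ha₁, ha₂, A, s, z, hs, hz, h₁, h₂⟩
  exact ⟨a, ⟨ha₁, ha₂⟩, A, s, z, hs, hz, h₁, h₂⟩

/-- The floor's predicate is the member `I = [47/50, 1]` of the family. -/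
theorem scaleGood_box_iff {R η : ℝ} {N : ℕ} (x : Fin N → E3) (i : Fin N) :
    ScaleGood (Set.Icc (47 / 50) 1) R η x i ↔ LayeredGood R η x i :=
  ⟨layeredGood_of_scaleGood_box x i, scaleGood_box_of_layeredGood x i⟩

/-- `ScaleGood I` is antitone in the radius and monotone in the tolerance. [folklore] -/
theorem scaleGood_mono_scale {I : Set ℝ} {R R' η η' : ℝ} (hR : R ≤ R') (hη : η' ≤ η) {N : ℕ}
    (x : Fin N → E3) (i : Fin N) : ScaleGood I R' η' x i → ScaleGood I R η x i := by
  rintro ⟨a, ha, A, s, z, hs, hz, h₁, h₂⟩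
  refine ⟨a, ha, A, s, z, hs, hz, ?_, ?_⟩
  · intro p hp hpR
    obtain ⟨j, hj⟩ := h₁ p hp (hpR.trans hR)
    exact ⟨j, hj.trans hη⟩
  · intro j hj
    obtain ⟨p, hp, hjp⟩ := h₂ j (hj.trans hR)
    exact ⟨p, hp, hjp.trans hη⟩

/-- The budget is monotone in the dial: a budget pricing the larger bad set prices the smaller one. -/
theorem scaleBudget_mono {I I' : Set ℝ} (hI : I ⊆ I') (P₀ : PeriodicConfiguration 3) :
    ScaleBudget I P₀ → ScaleBudget I' P₀ := by
  intro hB R η hR hη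
  obtain ⟨c, hc, hcB⟩ := hB R η hR hη
  refine ⟨c, hc, fun N x hx => le_trans ?_ (hcB N x hx)⟩
  have hle : Nat.card {i : Fin N // ¬ ScaleGood I' R η x i} ≤ Nat.card {i : Fin N // ¬ ScaleGood I R η x i} := by
    rw [Nat.card_eq_fintype_card, Nat.card_eq_fintype_card]
    exact Fintype.card_subtype_mono _ _ fun i hi hg => hi (scaleGood_mono hI x i hg)
  exact mul_le_mul_of_nonneg_left (by exact_mod_cast hle) hc.le

/-! ## F3 — the family specialises to the proved floor -/

/-- `ScaleRung [47/50, 1]` is the floor: the seed theorem followed by the proved `PeriodicGivenLayered`. -/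
theorem scaleRung_box : ScaleRung (Set.Icc (47 / 50) 1) := by
  intro P₀ hF hB x hx
  refine Theses.FluxTubeKepler.PeriodicGivenLayered_holds x hx
    (Theorems.FluxTubeKeplerFloorGivesLayered.FloorGivesLayered_proof P₀ hF ?_ x hx)
  intro R η hR hη
  obtain ⟨c, hc, hcB⟩ := hB R η hR hη
  refine ⟨c, hc, fun N y hy => ?_⟩
  show c * (Nat.card {i : Fin N // ¬ LayeredGood R η y i} : ℝ) ≤ _
  refine le_trans ?_ (hcB N y hy)
  have hle : Nat.card {i : Fin N // ¬ LayeredGood R η y i} ≤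
      Nat.card {i : Fin N // ¬ ScaleGood (Set.Icc (47 / 50) 1) R η y i} := by
    rw [Nat.card_eq_fintype_card, Nat.card_eq_fintype_card]
    exact Fintype.card_subtype_mono _ _ fun i hi hg => hi (layeredGood_of_scaleGood_box y i hg)
  exact mul_le_mul_of_nonneg_left (by exact_mod_cast hle) hc.le

/-! ## Dial monotonicity (harder-to-easier = shrinking the unpriced set `I`) -/

theorem scaleRung_anti {I I' : Set ℝ} (hI : I ⊆ I') : ScaleRung I' → ScaleRung I :=
  fun H P₀ hF hB x hx => H P₀ hF (scaleBudget_mono hI P₀ hB) x hx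

theorem box_subset_Ioi : Set.Icc (47 / 50 : ℝ) 1 ⊆ Set.Ioi 0 := fun a ha => by
  simp only [Set.mem_Icc, Set.mem_Ioi] at ha ⊢
  linarith [ha.1]

/-- The deciding rung gives every member below it, in particular the floor (informational `specialises`). -/
theorem scaleRung_of_scaleBlindRung {I : Set ℝ} (hI : I ⊆ Set.Ioi 0) (h : ScaleBlindRung) : ScaleRung I :=
  scaleRung_anti hI h

theorem scaleRung_box_of_scaleBlindRung (h : ScaleBlindRung) : ScaleRung (Set.Icc (47 / 50) 1) :=
  scaleRung_of_scaleBlindRung box_subset_Ioi h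


end Summit.AtomisticToContinuum.Crystallization.Cruxes.FluxCellKepler.ScaleLadder.Special

end
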